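import Summits.ABC.ABC.Theses.TwistAmplification
import Literature.NumberTheory.DiophantineGeometry.AbcShapeReductionCount
import Literature.NumberTheory.DiophantineGeometry.AbcShapeExponents
import Literature.NumberTheory.DiophantineGeometry.AbcShapeSubBox

/-!
# Crux `TwistAmplification.MazurKaneLaw` (stmt-ABC-2757), line `fibre-toolkit-lp-wall-map`: the toolkit vocabulary

Route-posited objects of the line `fibre-toolkit-lp-wall-map` (crux-plan skeleton
`Summits/ABC/ABC/Cruxes/MazurKaneLaw/Lines/fibre-toolkit-lp-wall-map.lean`, planner
planner-cruxplan-stmt-ABC-2757-fibre-toolkit-lp-wal-0; lead prover-line-stmt-ABC-2757-1), typed once here so that the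
stub files `TwistAmplificationMazurKaneLaw<Stub>.lean` can import them instead of restating them:

* the EXPONENT BOOKKEEPING of a shape datum `(C₀; c₁, c₂, c₃; X, Y, Z)` in the BBLT §6 dictionary
  (`AbcShapes.expo`, scale `Λ = 2C₀`): `scale`, `radExp` (`L = Σᵢ (αᵢ+βᵢ+γᵢ)`), `deficiency`
  (`e = 3 − Σⱼ log_Λ (cⱼ · shape value at the corner)`);
* the FIBRE TOOLKIT as linear certificates "`D ≤ θ`" on the exponents: `TrivialCertifies` (BBLT (6.4)),
  `GeometryCertifies` (subset geometry of numbers, BBLT Prop. 4.1 / (6.5)–(6.9)), `FourierCertifies` (BBLT Prop. 3.1 /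
  (6.10)), `DeterminantCertifies` (NEW to the linear programme: Heath-Brown's determinant method at a level `j ≥ 2` with
  the full coefficient modulus; `j = 2` is the sharp conic bound), their disjunction `Certified`, and the regions
  `Tame` (certified at the law `s − 1 + τ`), `Wild = ¬ Tame`, `Everywhere`;
* the BOX-LEVEL MAZUR–KANE LAW on a region, `BoxLawOn R s` (for every `η > 0`, all small `ε′`, `B_M ≤ K C₀^{s−1+η}` on
  admissible data in `R`), and the statement `DetTool` of the determinant tool in multiplicative form;
* the five stub statements of the line as named `Prop`s: `ShapeTransfer`, `ToolkitTame`, `WallResidual`,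
  `DeepResidual` (and `DetTool` itself is the second).

Nothing is proved here except two one-line sanity lemmas (`tame_or_wild`, `boxLawOn_everywhere_iff`). The
composition `ShapeTransfer → DetTool → ToolkitTame → WallResidual → DeepResidual → MazurKaneLaw` is in the
skeleton (and will land as `TwistAmplificationMazurKaneLawToolkit.lean` when the stubs close).

References: C. Bernert, T. Browning, J. D. Lichtman, J. Teräväinen, arXiv:2410.12234v2 §§2–6 (shapes, tools,
dictionary); D. R. Heath-Brown, Ann. of Math. 155 (2002) Thms 2–3 (determinant method); D. Kane, arXiv:1104.2635
(Conj. 1 = the crux; lattices + conics).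
-/

noncomputable section

-- `Summit.<Summit>.<Problem>` is the mandated summit-side namespace (CONVENTIONS §2); for the single-conjunct summit `ABC`
-- the two coincide, so the duplicate `ABC.ABC` is deliberate (the lakefile sets the same option tree-wide).
set_option linter.dupNamespace false

open Finset
open Literature.NumberTheory.DiophantineGeometry
open Literature.NumberTheory.DiophantineGeometry.AbcShapes

namespace Summit.ABC.ABC.Theorems.MazurKaneLaw.Toolkit

/-! ### Exponent bookkeeping of a shape datum (BBLT §6 dictionary: `Λ = 2C₀`, `αᵢ = log_Λ Xᵢ`,
coordinate `i` (from `0`) carries exponent `i + 1`) -/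

/-- The scale `Λ = 2C₀` of a class at dyadic level `C₀` (admissible data have `cᵢ · ∏ ·^{i+1} ≤ Λ`). -/
def scale (C₀ : ℕ) : ℝ := 2 * (C₀ : ℝ)

/-- The radical exponent `L = Σᵢ (αᵢ + βᵢ + γᵢ) = log_Λ ∏ᵢ XᵢYᵢZᵢ` of a box (`≤ s + 3ε′` on data admissible
for `(s, ε′)`). -/
def radExp {M : ℕ} (Λ : ℝ) (X Y Z : Fin M → ℕ) : ℝ :=
  ∑ i, (expo Λ X i + expo Λ Y i + expo Λ Z i)

/-- The total DEFICIENCY `e = 3 − Σⱼ log_Λ (cⱼ · shape value at the box corner)`: how far `a, b, c` (at the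
corner) fall short of the scale `Λ`; `e ≥ 0` on admissible data (each `cⱼ · shapeVal ≤ Λ`); the `c`-part is
`O(log_Λ V₂)`, the `a`-part is genuine for lopsided triples `a ≪ c^{1−e}`. It weakens exactly one tool, the
determinant method, whose modulus is the product of the three cofactors. -/
def deficiency {M : ℕ} (Λ : ℝ) (c₁ c₂ c₃ : ℕ) (X Y Z : Fin M → ℕ) : ℝ :=
  3 - (Real.logb Λ ((c₁ * shapeVal X : ℕ) : ℝ) + Real.logb Λ ((c₂ * shapeVal Y : ℕ) : ℝ) +
    Real.logb Λ ((c₃ * shapeVal Z : ℕ) : ℝ))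

/-! ### The fibre toolkit as linear certificates "`D ≤ θ`" on the exponents -/

/-- TRIVIAL tool [BBLT Prop. 2.3 / (6.4); tree `AbcShapes.trivial_linear`]: fixing two of the three shape tuples
determines the third up to a divisor function: `D ≤ A + B` (or `A + C`, or `B + C`), `A = Σ αᵢ` etc.; the
certificate at `θ` is that one of the three sums is `≤ θ`. -/
def TrivialCertifies {M : ℕ} (Λ θ : ℝ) (X Y Z : Fin M → ℕ) : Prop :=
  (∑ i, expo Λ X i + ∑ i, expo Λ Y i ≤ θ) ∨ (∑ i, expo Λ X i + ∑ i, expo Λ Z i ≤ θ) ∨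
    (∑ i, expo Λ Y i + ∑ i, expo Λ Z i ≤ θ)

/-- GEOMETRY-OF-NUMBERS tool with arbitrary index sets `I, J, K` ("subset GoN") [BBLT Prop. 4.1 / (6.5)–(6.9);
tree `AbcShapes.shapeCount_le_geometry_sets`, `AbcShapes.geometry_disjunction`]:
`D ≤ max(L − (Σ_I α + Σ_J β + Σ_K γ), L − 1 + (Σ_I i αᵢ + Σ_J i βᵢ + Σ_K i γᵢ))` — the "+1" (number of
lattices) and the main term (volume / covolume); Kane's lattices are `I = J = K = {0}`. The certificate at `θ` is
that both branches are `≤ θ` for some `I, J, K`. -/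
def GeometryCertifies {M : ℕ} (Λ θ : ℝ) (X Y Z : Fin M → ℕ) : Prop :=
  ∃ I J K : Finset (Fin M),
    radExp Λ X Y Z - (∑ i ∈ I, expo Λ X i + ∑ i ∈ J, expo Λ Y i + ∑ i ∈ K, expo Λ Z i) ≤ θ ∧
    radExp Λ X Y Z - 1 +
      (∑ i ∈ I, (i : ℝ) * expo Λ X i + ∑ i ∈ J, (i : ℝ) * expo Λ Y i + ∑ i ∈ K, (i : ℝ) * expo Λ Z i) ≤ θ

/-- FOURIER tool with saved sets [BBLT Prop. 3.1 / (6.10); tree `AbcShapes.shapeCount_pow_six_mul_le_sets`,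
`AbcShapes.fourier_linear`]: for sets `S_U, S_V, S_W` of coordinates whose exponents `i + 1` are multiples of
`e_U, e_V, e_W ≥ 2`, `6D ≤ 4L − (Σ_{S_U} α + Σ_{S_V} β + Σ_{S_W} γ)`; the certificate at `θ` is
`(4L − saved)/6 ≤ θ` for some such choice. -/
def FourierCertifies {M : ℕ} (Λ θ : ℝ) (X Y Z : Fin M → ℕ) : Prop :=
  ∃ (SU SV SW : Finset (Fin M)) (eU eV eW : ℕ), 2 ≤ eU ∧ 2 ≤ eV ∧ 2 ≤ eW ∧
    (∀ i ∈ SU, eU ∣ (i : ℕ) + 1) ∧ (∀ i ∈ SV, eV ∣ (i : ℕ) + 1) ∧ (∀ i ∈ SW, eW ∣ (i : ℕ) + 1) ∧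
    (4 * radExp Λ X Y Z - (∑ i ∈ SU, expo Λ X i + ∑ i ∈ SV, expo Λ Y i + ∑ i ∈ SW, expo Λ Z i)) / 6 ≤ θ

/-- DETERMINANT tool at a coordinate `i ≥ 1` (level `j = i + 1 ≥ 2`; NEW to the BBLT linear programme; exponent
form of `DetTool`): fix every variable off coordinate `i`; the fibre `A xʲ + B yʲ = C zʲ` has
`≪ Λ^{o(1)} (1 + (XᵢYᵢZᵢ / (ABC))^{1/3})` primitive points (Heath-Brown's determinant method with the full modulus
`ABC`, available because the unknowns are coprime to the coefficients inside an abc triple; at `j = 2` the sharp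
conic bound), and `log_Λ (ABC) ≥ 3 − e − (j+1) pᵢ` at the corner, so
`D ≤ max(L − pᵢ, L − 1 + ((j − 2) pᵢ + e)/3)` with `pᵢ = αᵢ + βᵢ + γᵢ`, `j − 2 = i − 1`, `e = deficiency`.
The certificate at `θ` is that both branches are `≤ θ` for some `i ≥ 1`. -/
def DeterminantCertifies {M : ℕ} (Λ θ : ℝ) (c₁ c₂ c₃ : ℕ) (X Y Z : Fin M → ℕ) : Prop :=
  ∃ i : Fin M, 1 ≤ (i : ℕ) ∧
    radExp Λ X Y Z - (expo Λ X i + expo Λ Y i + expo Λ Z i) ≤ θ ∧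
    radExp Λ X Y Z - 1 +
      ((((i : ℕ) : ℝ) - 1) * (expo Λ X i + expo Λ Y i + expo Λ Z i) + deficiency Λ c₁ c₂ c₃ X Y Z) / 3 ≤ θ

/-- A shape datum is CERTIFIED at exponent `θ` (scale `Λ`) when some tool of the kit certifies `D ≤ θ`:
trivial, subset geometry of numbers, Fourier with saved sets, or determinant. -/
def Certified {M : ℕ} (Λ θ : ℝ) (c₁ c₂ c₃ : ℕ) (X Y Z : Fin M → ℕ) : Prop :=
  TrivialCertifies Λ θ X Y Z ∨ GeometryCertifies Λ θ X Y Z ∨ FourierCertifies Λ θ X Y Z ∨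
    DeterminantCertifies Λ θ c₁ c₂ c₃ X Y Z

/-- A shape datum at dyadic level `C₀` is TAME at `(s, τ)` when the kit certifies the Mazur–Kane exponent up to
`τ`: `Certified (2C₀) (s − 1 + τ)`. (`M` enters only through the types.) -/
def Tame (M : ℕ) (s τ : ℝ) (C₀ c₁ c₂ c₃ : ℕ) (X Y Z : Fin M → ℕ) : Prop :=
  Certified (scale C₀) (s - 1 + τ) c₁ c₂ c₃ X Y Z

/-- WILD = not tame: no fibre tool reaches the law. This is the residue of the crux after the whole existing
toolkit (the "wall map" of the line card): for `s ∈ [12/7, 2)` its worst boxes are the wall family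
`(p₁, p₂, p₃) = (s−1, s−1, 2−s)`, i.e. `a, b, c = u·x²·w³` with `u ≍ x ≍ N^{(s−1)/3}`, `w ≍ N^{(2−s)/3}`. -/
def Wild (M : ℕ) (s τ : ℝ) (C₀ c₁ c₂ c₃ : ℕ) (X Y Z : Fin M → ℕ) : Prop :=
  ¬ Tame M s τ C₀ c₁ c₂ c₃ X Y Z

/-- The trivial region (every datum). -/
def Everywhere (M : ℕ) (_s _τ : ℝ) (_C₀ _c₁ _c₂ _c₃ : ℕ) (_X _Y _Z : Fin M → ℕ) : Prop := True

/-- A region of shape data: a predicate on `(M; s, τ; C₀, c₁, c₂, c₃; X, Y, Z)`. -/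
abbrev Region : Type :=
  (M : ℕ) → ℝ → ℝ → ℕ → ℕ → ℕ → ℕ → (Fin M → ℕ) → (Fin M → ℕ) → (Fin M → ℕ) → Prop

/-- Every datum is tame or wild (excluded middle; the glue of the composition; registered sub-goal `tame_or_wild` of
crux stmt-ABC-2757, stated verbatim). -/
theorem tame_or_wild : ∀ (M : ℕ) (s τ : ℝ) (C₀ c₁ c₂ c₃ : ℕ) (X Y Z : Fin M → ℕ), Summit.ABC.ABC.Theorems.MazurKaneLaw.Toolkit.Tame M s τ C₀ c₁ c₂ c₃ X Y Z ∨ Summit.ABC.ABC.Theorems.MazurKaneLaw.Toolkit.Wild M s τ C₀ c₁ c₂ c₃ X Y Z :=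
  fun _ _ _ _ _ _ _ _ _ _ => Classical.em _

/-! ### The box-level Mazur–Kane law on a region, and the determinant tool -/

/-- THE BOX-LEVEL MAZUR–KANE LAW ON A REGION `R` at exponent `s`: for every `η > 0` and all sufficiently small
`ε′` (hence `M = ⌊10/ε′²⌋` levels, `AbcShapes.numShapes`) there is `K ≥ 0` with `B_M(c; X, Y, Z) ≤ K · C₀^{s−1+η}` for
all data admissible for `(s, ε′)` (`AbcShapes.Admissible`: `cᵢ ≤ Λ^{ε′/2}`, `∏ XᵢYᵢZᵢ ≤ Λ^{s+3ε′}`,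
`cᵢ · shape value ≤ Λ = 2C₀`, `C₀ ≤ V₂ c₃ ∏ Zᵢ^{i+1}`) lying in `R` with tolerance `τ = η/2`. Implied (for every `R`)
by the crux at `s + O(ε′)` (each counted shape solution is an abc triple of exponent `< s + 3ε′ + o(1)`,
represented `Λ^{o(1)}` times), so the residual statements `WallResidual` / `DeepResidual` are pieces of the
conjecture, not strengthenings of it; the `ε′`-threshold `ε₀(η)` is the prover's to choose. -/
def BoxLawOn (R : Region) (s : ℝ) : Prop :=
  ∀ η : ℝ, 0 < η → ∃ ε₀ : ℝ, 0 < ε₀ ∧ ∀ ε' : ℝ, 0 < ε' → ε' ≤ ε₀ → ∃ K : ℝ, 0 ≤ K ∧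
    ∀ (C₀ c₁ c₂ c₃ : ℕ) (X Y Z : Fin (numShapes ε') → ℕ),
      Admissible s ε' C₀ c₁ c₂ c₃ X Y Z →
        R (numShapes ε') s (η / 2) C₀ c₁ c₂ c₃ X Y Z →
          (shapeCount c₁ c₂ c₃ X Y Z : ℝ) ≤ K * (C₀ : ℝ) ^ (s - 1 + η)

/-- The law on `Everywhere` is the plain box law (the region hypothesis is `True`). -/
theorem boxLawOn_everywhere_iff (s : ℝ) :
    BoxLawOn Everywhere s ↔
      ∀ η : ℝ, 0 < η → ∃ ε₀ : ℝ, 0 < ε₀ ∧ ∀ ε' : ℝ, 0 < ε' → ε' ≤ ε₀ → ∃ K : ℝ, 0 ≤ K ∧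
        ∀ (C₀ c₁ c₂ c₃ : ℕ) (X Y Z : Fin (numShapes ε') → ℕ),
          Admissible s ε' C₀ c₁ c₂ c₃ X Y Z → (shapeCount c₁ c₂ c₃ X Y Z : ℝ) ≤ K * (C₀ : ℝ) ^ (s - 1 + η) := by
  refine forall₂_congr fun η _ => exists_congr fun ε₀ => and_congr_right fun _ =>
    forall₃_congr fun ε' _ _ => exists_congr fun K => and_congr_right fun _ => ?_
  exact ⟨fun h C₀ c₁ c₂ c₃ X Y Z hA => h C₀ c₁ c₂ c₃ X Y Z hA trivial,
    fun h C₀ c₁ c₂ c₃ X Y Z hA _ => h C₀ c₁ c₂ c₃ X Y Z hA⟩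

/-- THE DETERMINANT TOOL (statement; multiplicative form; the `j = 2` case is the sharp conic bound of
Heath-Brown 2002 Cor. 2 / Le Boudec Lemma 2 / Browning–Van Valckenborgh Lemma 3): for the shape count `B_d` and
a coordinate `i ≥ 1`, with `T` a common bound for the three terms at the outer corner, `Dτ` a divisor bound below
`T`, and `P` any real past the auxiliary-prime threshold (`N₀ ≤ P`, `2 log((i+2)T³) ≤ P`) and past the cube root
`48 XᵢYᵢZᵢ ≤ A₀B₀C₀ · P³` (`A₀ = c₁ · offVal_{{i}}(X)` the corner cofactor of `xᵢ^{i+1}`, similarly `B₀, C₀`):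
`B_d ≤ #fibres · Dτ^{3(i+2)} · 24 (i+1)(i+2) · P`, `#fibres = ∏_{j ≠ i} XⱼYⱼZⱼ` (written with `subBox {i}`).
Provable now from `SquarefulDet.fiberBound` (stub S2 of the line). -/
def DetTool : Prop :=
  ∃ N₀ : ℝ, 0 < N₀ ∧ ∀ {d : ℕ} {c₁ c₂ c₃ : ℕ}, 0 < c₁ → 0 < c₂ → 0 < c₃ →
    ∀ (X Y Z : Fin d → ℕ), (∀ j, 0 < X j) → (∀ j, 0 < Y j) → (∀ j, 0 < Z j) →
    ∀ {T Dτ : ℕ}, c₁ * shapeVal (fun j => 2 * X j) ≤ T → c₂ * shapeVal (fun j => 2 * Y j) ≤ T →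
      c₃ * shapeVal (fun j => 2 * Z j) ≤ T → (∀ m : ℕ, m ≠ 0 → m ≤ T → m.divisors.card ≤ Dτ) →
    ∀ i : Fin d, 1 ≤ (i : ℕ) → ∀ P : ℝ, N₀ ≤ P →
      2 * Real.log ((((i : ℕ) : ℝ) + 2) * (T : ℝ) ^ 3) ≤ P →
      48 * ((X i : ℝ) * Y i * Z i) ≤
        ((c₁ * offVal ({i} : Finset (Fin d)) X : ℕ) : ℝ) * ((c₂ * offVal ({i} : Finset (Fin d)) Y : ℕ) : ℝ) *
          ((c₃ * offVal ({i} : Finset (Fin d)) Z : ℕ) : ℝ) * P ^ 3 →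
      (shapeCount c₁ c₂ c₃ X Y Z : ℝ) ≤
        ((subBox ({i} : Finset (Fin d)) X).card * (subBox ({i} : Finset (Fin d)) Y).card *
            (subBox ({i} : Finset (Fin d)) Z).card : ℕ) *
          (Dτ : ℝ) ^ (3 * ((i : ℕ) + 2)) * (24 * ((((i : ℕ) : ℝ) + 1) * (((i : ℕ) : ℝ) + 2))) * P

/-! ### The stub statements of the line as named `Prop`s -/

/-- STUB S1 statement (the transfer `C⁺ → crux`): the box law everywhere at every `s′ ∈ (1, 2)` implies
`MazurKaneLaw` (pattern `bernertEtAl2024_thm_1_3_holds`: `s′ = min(s + ε/3, (s+2)/2)` absorbs `rad ≤ c^s` into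
`rad < c^{s′}`, then `abcExponentCount_le_of_shapeCount_le` + `card_classRange_le`). -/
def ShapeTransfer : Prop :=
  (∀ s : ℝ, 1 < s → s < 2 → BoxLawOn Everywhere s) → Summit.ABC.ABC.Theses.TwistAmplification.MazurKaneLaw

/-- STUB S3 statement: with the determinant tool, TAME boxes obey the law at every `s ∈ (1, 2)` (the exponent
dictionary `trivial_linear` / `geometry_disjunction` / `fourier_linear` / a `det_linear` read off `DetTool`, plus
the endgame constants of `AbcShapeEndgame13`; no linear programme is solved — the certificate is the hypothesis). -/
def ToolkitTame : Prop :=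
  DetTool → ∀ s : ℝ, 1 < s → s < 2 → BoxLawOn Tame s

/-- STUB S4 statement (OPEN; the line's target): WILD boxes obey the law for `s ∈ [5/3, 2)` — at the binding
radical level the wild region is the wall triangle `p₁ < 1, p₂ < 1, 2p₁ + p₂ ≥ 3(s−1)`, worst point the wall
family `a, b, c = u x² w³`; a full saving `N^{−(2−s)}` over "+1 per fibre" is what is asked. -/
def WallResidual : Prop :=
  ∀ s : ℝ, 5 / 3 ≤ s → s < 2 → BoxLawOn Wild s

/-- STUB S5 statement (OPEN, hardest; not attacked by the line): WILD boxes obey the law for `s ∈ (1, 5/3)`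
(cube-heavy and twisted-Fermat boxes; as `s → 1⁺` it contains "abc hits `≪ N^δ` for every `δ > 0`"). -/
def DeepResidual : Prop :=
  ∀ s : ℝ, 1 < s → s < 5 / 3 → BoxLawOn Wild s

end Summit.ABC.ABC.Theorems.MazurKaneLaw.Toolkit

end
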